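import Mathlib
import Summits.Ventures.HodgeRepro2.T5QuadraticCharactersContinuous
import Summits.Ventures.HodgeRepro2.T5AdicCompletionNormGroup
import Summits.Ventures.HodgeRepro2.T5AdicCompletionEmbedding
import Summits.Ventures.HodgeRepro2.T5TameRamifiedUnitNorms
import Summits.Ventures.HodgeRepro2.T5UnitsResidueQuotient
import Summits.Ventures.HodgeRepro2.T5PrincipalUnitsDivisible

/-!
# The square classes of `Kvˣ`: `(Kvˣ)²` is an open subgroup of finite index, `[Kvˣ : (Kvˣ)²] = 2 [O_Kvˣ : O_Kvˣ ∩ (Kvˣ)²]`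

`Kv = v.adicCompletion K` at a finite place `v`, `squares v = (x ↦ x²).range ≤ Kvˣ`.

* `isOpen_squares`: the squares form an OPEN subgroup (`T5QuadraticCharactersContinuous`: every
  subgroup containing the squares is open);
* `finiteIndex_squares_subgroupOf`: `(Kvˣ)² ∩ O_Kvˣ` has finite index in the compact `O_Kvˣ`;
* `mem_squares_sup_adicIntegerUnits_iff`: `(Kvˣ)² · O_Kvˣ = {y | log v(y) even}` (for a uniformiser
  `ϖ`: `y = u ϖ^n`, `n` even iff `y ∈ (Kvˣ)² O_Kvˣ`), so **`index_squares_sup_adicIntegerUnits = 2`**;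
* **`finiteIndex_squares`** and **`index_squares_eq`**: `[Kvˣ : (Kvˣ)²] = 2 · [O_Kvˣ : O_Kvˣ ∩ (Kvˣ)²]`,
  finite — the group of square classes of a local field is finite (so `Kvˣ` has only finitely many
  characters of order `≤ 2`, all continuous by `T5QuadraticCharactersContinuous`);
* `2 ∈ O_Kvˣ` (residue characteristic `≠ 2`): a unit with square residue is a square
  (`exists_units_sq_eq_of_mem_residueSquares`), the preimage of `(Kvˣ)²` in `O_Kvˣ` is
  `residueSquares` (`comap_squares_eq`), so `[O_Kvˣ : O_Kvˣ ∩ (Kvˣ)²] = 2` (`T5TameRamifiedUnitNorms`)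
  and **`index_squares_of_isUnit_two : [Kvˣ : (Kvˣ)²] = 4`** — a non-dyadic local field has exactly
  four square classes (hence exactly three quadratic extensions).

Serre, *Local Fields*, Ch. XIV §4 (the square classes of `ℚ₂` through `U/U'`, `U' = 1 + 8ℤ₂`).

Declaration per README §8(d): «uses an L-value-free non-vanishing device: NO».
-/

namespace Summit.Ventures.HodgeRepro2.T5SquareClasses

open IsDedekindDomain HeightOneSpectrum IsLocalRing WithZero T5AdicCompletionNormGroup

variable {K : Type*} [Field K] [NumberField K] (v : HeightOneSpectrum (NumberField.RingOfIntegers K))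

/-- The subgroup of squares of `Kvˣ`. -/
noncomputable def squares : Subgroup (adicCompletion K v)ˣ :=
  (powMonoidHom 2 : (adicCompletion K v)ˣ →* (adicCompletion K v)ˣ).range

/-- Membership in `squares`. -/
theorem mem_squares_iff (y : (adicCompletion K v)ˣ) :
    y ∈ squares v ↔ ∃ x : (adicCompletion K v)ˣ, x ^ 2 = y := by
  simp only [squares, MonoidHom.mem_range, powMonoidHom_apply]

/-- `x² ∈ squares`. -/
theorem sq_mem_squares (x : (adicCompletion K v)ˣ) : x ^ 2 ∈ squares v :=
  (mem_squares_iff v _).mpr ⟨x, rfl⟩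

/-- THE SQUARES FORM AN OPEN SUBGROUP of `Kvˣ`. -/
theorem isOpen_squares : IsOpen ((squares v : Subgroup (adicCompletion K v)ˣ) : Set (adicCompletion K v)ˣ) :=
  T5QuadraticCharactersContinuous.isOpen_of_forall_sq_mem v _ (sq_mem_squares v)

/-- `(Kvˣ)² ∩ O_Kvˣ` has finite index in the compact `O_Kvˣ`. -/
theorem finiteIndex_squares_subgroupOf :
    ((squares v).subgroupOf (T5AdicCompletionEmbedding.adicIntegerUnits v)).FiniteIndex := by
  have hopen : IsOpen (((squares v).subgroupOf (T5AdicCompletionEmbedding.adicIntegerUnits v) :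
      Subgroup (T5AdicCompletionEmbedding.adicIntegerUnits v)) :
        Set (T5AdicCompletionEmbedding.adicIntegerUnits v)) := by
    rw [Subgroup.subgroupOf, Subgroup.coe_comap, Subgroup.coe_subtype]
    exact (isOpen_squares v).preimage continuous_subtype_val
  haveI : Finite ((T5AdicCompletionEmbedding.adicIntegerUnits v) ⧸
      (squares v).subgroupOf (T5AdicCompletionEmbedding.adicIntegerUnits v)) :=
    Subgroup.quotient_finite_of_isOpen _ hopen
  exact Subgroup.finiteIndex_of_finite_quotient

section Units

/-- A unit of `O_Kv` (as an element of `adicIntegerUnits`) has valuation `1`. -/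
theorem val_eq_one_of_mem_adicIntegerUnits {u : (adicCompletion K v)ˣ}
    (hu : u ∈ T5AdicCompletionEmbedding.adicIntegerUnits v) : Valued.v (u : adicCompletion K v) = 1 := by
  rw [T5AdicCompletionEmbedding.mem_adicIntegerUnits_iff, mem_adicCompletionIntegers,
    mem_adicCompletionIntegers, Units.val_inv_eq_inv_val, map_inv₀] at hu
  obtain ⟨h1, h2⟩ := hu
  have hpos : 0 < Valued.v (u : adicCompletion K v) :=
    lt_of_le_of_ne zero_le (Ne.symm ((Valuation.ne_zero_iff _).mpr u.ne_zero))
  exact le_antisymm h1 ((inv_le_one₀ hpos).mp h2)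

/-- An element of valuation `1` lies in `adicIntegerUnits`. -/
theorem mem_adicIntegerUnits_of_val_eq_one {u : (adicCompletion K v)ˣ}
    (hu : Valued.v (u : adicCompletion K v) = 1) : u ∈ T5AdicCompletionEmbedding.adicIntegerUnits v := by
  rw [T5AdicCompletionEmbedding.mem_adicIntegerUnits_iff, mem_adicCompletionIntegers,
    mem_adicCompletionIntegers, Units.val_inv_eq_inv_val, map_inv₀, hu, inv_one]
  exact ⟨le_rfl, le_rfl⟩

end Units

section Uniformizer

variable {ϖ : adicCompletionIntegers K v} (hϖ : Irreducible ϖ)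

/-- A square times a unit has an even valuation exponent. -/
theorem even_log_val_of_mem_squares_sup_adicIntegerUnits {y : (adicCompletion K v)ˣ}
    (hy : y ∈ squares v ⊔ T5AdicCompletionEmbedding.adicIntegerUnits v) :
    Even (Valued.v (y : adicCompletion K v)).log := by
  obtain ⟨s, hs, u, hu, rfl⟩ := Subgroup.mem_sup.mp hy
  obtain ⟨x, rfl⟩ := (mem_squares_iff v s).mp hs
  have hu1 : Valued.v (u : adicCompletion K v) = 1 := val_eq_one_of_mem_adicIntegerUnits v hu
  rw [Units.val_mul, map_mul, hu1, mul_one, Units.val_pow_eq_pow_val, map_pow, log_pow]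
  exact ⟨(Valued.v (x : adicCompletion K v)).log, by rw [two_nsmul]⟩

include hϖ in
/-- An element of even valuation exponent is a square times a unit: `y = u · (ϖ^m)²`. -/
theorem mem_squares_sup_adicIntegerUnits_of_even_log_val {y : (adicCompletion K v)ˣ}
    (hy : Even (Valued.v (y : adicCompletion K v)).log) :
    y ∈ squares v ⊔ T5AdicCompletionEmbedding.adicIntegerUnits v := by
  obtain ⟨m, hm⟩ := hy
  obtain ⟨u, hu1, hu⟩ := T5UnramifiedCharacter.exists_val_eq_one_mul_zpow (val_uniformizer v hϖ)
    y.ne_zero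
  have hu0 : u ≠ 0 := by
    intro h; rw [h, map_zero] at hu1; exact zero_ne_one hu1
  refine Subgroup.mem_sup.mpr ⟨(uniformizerUnit v hϖ ^ (-m)) ^ 2, sq_mem_squares v _,
    Units.mk0 u hu0, mem_adicIntegerUnits_of_val_eq_one v (by rw [Units.val_mk0]; exact hu1), ?_⟩
  apply Units.ext
  rw [Units.val_mul, Units.val_pow_eq_pow_val, Units.val_zpow_eq_zpow_val, coe_uniformizerUnit,
    Units.val_mk0, hu, hm, mul_comm]
  rw [← zpow_natCast, ← zpow_mul]
  congr 2
  push_cast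
  ring

include hϖ in
/-- `(Kvˣ)² · O_Kvˣ = {y | log v(y) even}`. -/
theorem mem_squares_sup_adicIntegerUnits_iff (y : (adicCompletion K v)ˣ) :
    y ∈ squares v ⊔ T5AdicCompletionEmbedding.adicIntegerUnits v ↔
      Even (Valued.v (y : adicCompletion K v)).log :=
  ⟨even_log_val_of_mem_squares_sup_adicIntegerUnits v, mem_squares_sup_adicIntegerUnits_of_even_log_val v hϖ⟩

include hϖ in
/-- `[Kvˣ : (Kvˣ)² · O_Kvˣ] = 2`. -/
theorem index_squares_sup_adicIntegerUnits :
    (squares v ⊔ T5AdicCompletionEmbedding.adicIntegerUnits v).index = 2 := by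
  rw [Subgroup.index_eq_two_iff]
  refine ⟨uniformizerUnit v hϖ, fun b => ?_⟩
  rw [mem_squares_sup_adicIntegerUnits_iff v hϖ, mem_squares_sup_adicIntegerUnits_iff v hϖ,
    Units.val_mul, map_mul, log_mul ((Valuation.ne_zero_iff _).mpr b.ne_zero)]
  · rw [coe_uniformizerUnit, val_uniformizer v hϖ, log_exp]
    rcases Int.even_or_odd (Valued.v (b : adicCompletion K v)).log with h | h
    · right
      refine ⟨h, ?_⟩
      rw [Int.not_even_iff_odd, ← sub_eq_add_neg]
      exact h.sub_odd odd_one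
    · left
      refine ⟨?_, ?_⟩
      · rw [← sub_eq_add_neg]; exact h.sub_odd odd_one
      · rw [Int.not_even_iff_odd]; exact h
  · exact (Valuation.ne_zero_iff _).mpr (uniformizerUnit v hϖ).ne_zero

include hϖ in
/-- `[Kvˣ : (Kvˣ)²] = 2 · [O_Kvˣ : O_Kvˣ ∩ (Kvˣ)²]`. -/
theorem index_squares_eq :
    (squares v).index = 2 * (squares v).relIndex (T5AdicCompletionEmbedding.adicIntegerUnits v) := by
  rw [← Subgroup.relIndex_mul_index (le_sup_left : squares v ≤ squares v ⊔ T5AdicCompletionEmbedding.adicIntegerUnits v),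
    index_squares_sup_adicIntegerUnits v hϖ, Subgroup.relIndex_sup_left, mul_comm]

include hϖ in
/-- THE GROUP OF SQUARE CLASSES OF `Kv` IS FINITE: `(Kvˣ)²` has finite index in `Kvˣ`. -/
theorem finiteIndex_squares : (squares v).FiniteIndex := by
  haveI := finiteIndex_squares_subgroupOf v
  refine ⟨?_⟩
  rw [index_squares_eq v hϖ]
  exact mul_ne_zero two_ne_zero Subgroup.FiniteIndex.index_ne_zero

end Uniformizer

section Tame

variable (h2u : IsUnit (2 : adicCompletionIntegers K v))

include h2u in
/-- `2 ∈ O_Kvˣ`: a unit of `O_Kv` whose residue is a square is the square of a unit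
(`u / a₀²` has residue `1` for a lift `a₀` of the square root, and principal units are squares,
`T5PrincipalUnitsDivisible`). -/
theorem exists_units_sq_eq_of_mem_residueSquares {u : (adicCompletionIntegers K v)ˣ}
    (hu : u ∈ T5TameRamifiedUnitNorms.residueSquares v) :
    ∃ w : (adicCompletionIntegers K v)ˣ, w ^ 2 = u := by
  rw [T5TameRamifiedUnitNorms.mem_residueSquares_iff] at hu
  obtain ⟨r, hr⟩ := hu
  obtain ⟨a₀, ha₀⟩ := residue_surjective r
  have hr0 : r ≠ 0 := by
    intro h
    rw [h, mul_zero] at hr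
    exact ((residue_ne_zero_iff_isUnit _).mpr u.isUnit) hr
  have ha₀u : IsUnit a₀ := (residue_ne_zero_iff_isUnit _).mp (by rw [ha₀]; exact hr0)
  set A : (adicCompletionIntegers K v)ˣ := ha₀u.unit with hAdef
  have hA : ((T5UnitsResidueQuotient.unitsResidue v A :
      (ResidueField (adicCompletionIntegers K v))ˣ) : ResidueField (adicCompletionIntegers K v)) = r := by
    rw [T5UnitsResidueQuotient.coe_unitsResidue, hAdef, IsUnit.unit_spec, ha₀]
  have hU : ((T5UnitsResidueQuotient.unitsResidue v u :
      (ResidueField (adicCompletionIntegers K v))ˣ) : ResidueField (adicCompletionIntegers K v)) = r * r := by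
    rw [T5UnitsResidueQuotient.coe_unitsResidue, hr]
  set x : (adicCompletionIntegers K v)ˣ := u * (A⁻¹) ^ 2 with hxdef
  have hx : residue (adicCompletionIntegers K v) (x : adicCompletionIntegers K v) = 1 := by
    have h : ((T5UnitsResidueQuotient.unitsResidue v x :
        (ResidueField (adicCompletionIntegers K v))ˣ) : ResidueField (adicCompletionIntegers K v)) = 1 := by
      rw [hxdef, map_mul, map_pow, map_inv, Units.val_mul, Units.val_pow_eq_pow_val,
        Units.val_inv_eq_inv_val, hU, hA]
      field_simp
    rw [← T5UnitsResidueQuotient.coe_unitsResidue, h]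
  obtain ⟨w, -, hw⟩ := T5PrincipalUnitsDivisible.exists_units_pow_eq_of_residue_eq_one v
    (n := 2) (by rw [Nat.cast_ofNat]; exact h2u) x hx
  refine ⟨w * A, ?_⟩
  rw [mul_pow, hw, hxdef, mul_assoc, ← mul_pow, inv_mul_cancel, one_pow, mul_one]

/-- The units map `O_Kvˣ →* Kvˣ`; its range is `adicIntegerUnits v`. -/
theorem range_unitsMap :
    (Units.map ((adicCompletionIntegers K v).subtype :
      adicCompletionIntegers K v →* adicCompletion K v)).range =
      T5AdicCompletionEmbedding.adicIntegerUnits v := rfl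

/-- A unit of `Kv` whose square is integral is integral. -/
theorem mem_adicIntegerUnits_of_sq_mem {y : (adicCompletion K v)ˣ}
    (hy : y ^ 2 ∈ T5AdicCompletionEmbedding.adicIntegerUnits v) :
    y ∈ T5AdicCompletionEmbedding.adicIntegerUnits v := by
  apply mem_adicIntegerUnits_of_val_eq_one
  have h := val_eq_one_of_mem_adicIntegerUnits v hy
  rw [Units.val_pow_eq_pow_val, map_pow] at h
  have hne : Valued.v (y : adicCompletion K v) ≠ 0 := (Valuation.ne_zero_iff _).mpr y.ne_zero
  have hlog : (Valued.v (y : adicCompletion K v)).log = 0 := by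
    have := congrArg WithZero.log h
    rw [log_pow, log_one, nsmul_eq_mul] at this
    omega
  rw [← exp_log hne, hlog, exp_zero]

include h2u in
/-- `2 ∈ O_Kvˣ`: the preimage of `(Kvˣ)²` in `O_Kvˣ` is the subgroup of units with square residue. -/
theorem comap_squares_eq :
    (squares v).comap (Units.map ((adicCompletionIntegers K v).subtype :
      adicCompletionIntegers K v →* adicCompletion K v)) = T5TameRamifiedUnitNorms.residueSquares v := by
  ext x
  rw [Subgroup.mem_comap, mem_squares_iff]
  constructor
  · rintro ⟨y, hy⟩
    have hyU : y ∈ T5AdicCompletionEmbedding.adicIntegerUnits v :=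
      mem_adicIntegerUnits_of_sq_mem v (by rw [hy]; exact ⟨x, rfl⟩)
    obtain ⟨z, rfl⟩ := hyU
    rw [← map_pow] at hy
    have hzx : z ^ 2 = x := Units.map_injective Subtype.val_injective hy
    rw [T5TameRamifiedUnitNorms.mem_residueSquares_iff, ← hzx, Units.val_pow_eq_pow_val, map_pow, sq]
    exact ⟨_, rfl⟩
  · intro hx
    obtain ⟨w, hw⟩ := exists_units_sq_eq_of_mem_residueSquares v h2u hx
    exact ⟨Units.map _ w, by rw [← hw, map_pow]⟩

include h2u in
/-- `2 ∈ O_Kvˣ`: `[O_Kvˣ : O_Kvˣ ∩ (Kvˣ)²] = 2`. -/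
theorem relIndex_squares_adicIntegerUnits :
    (squares v).relIndex (T5AdicCompletionEmbedding.adicIntegerUnits v) = 2 := by
  rw [← range_unitsMap, ← Subgroup.index_comap, comap_squares_eq v h2u,
    T5TameRamifiedUnitNorms.index_residueSquares_eq_two v h2u]

include h2u in
/-- A NON-DYADIC LOCAL FIELD HAS EXACTLY FOUR SQUARE CLASSES: `[Kvˣ : (Kvˣ)²] = 4` when `2 ∈ O_Kvˣ`. -/
theorem index_squares_of_isUnit_two {ϖ : adicCompletionIntegers K v} (hϖ : Irreducible ϖ) :
    (squares v).index = 4 := by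
  rw [index_squares_eq v hϖ, relIndex_squares_adicIntegerUnits v h2u]

end Tame

end Summit.Ventures.HodgeRepro2.T5SquareClasses
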